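import Mathlib
import Summits.QuantumAdvantage.AdviceFreeQNC0.OddPrimeStatements
import Summits.QuantumAdvantage.AdviceFreeQNC0.WalkFailFloor
import Summits.QuantumAdvantage.AdviceFreeQNC0.WalkGapNaming
import Literature.Computability.MetaComplexity.RazborovSmolenskyPoly

set_option linter.dupNamespace false

/-!
# AbsorptionDial (E) — the bottom rung of the `𝔽_p` degree dial: degree-1 strategies lose on `≥ 2^{n−5}` inputs (cell decomp-qadv, lens 4, g14)

Prop-definition-free; independent of parts A–D (supports of item stmt-QuantumAdvantage-26994 ≡ 26767: the proved
bottom rung of the degree dial `D ↦ «no cut-degree-D strategy is perfect»`, whose polylog rung is the route's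
`NoPerfectPolyOdd` and whose top rung `D = n` is false by the charge reader).

* `affine_of_mem_lowDeg_one` — `lowDeg F n 1` functions are affine `a₀ + Σ aᵢxᵢ` on the cube (span induction);
* `junta_one_of_hasDegF_one` — **rigidity at degree one**: for `p ≠ 2` a Boolean function of `𝔽_p`-degree `≤ 1`
  depends on at most one bit (evaluate the affine form at `0, eᵢ, eⱼ, eᵢ+eⱼ`: two nonzero slopes force `2 = 0`);
* `hasDeg_of_hasDegF_one` — hence `𝔽_p`-degree `≤ 1` ⟹ `𝔽₂`-degree `≤ 1` (every prime; at `p = 2` the predicates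
  coincide), via the tree's pattern-degree lemma `GapFibre.ind_mem_lowDeg_of_pattern`;
* `degOne_fail_floor`, `degOne_win_le` — the `𝔽₂` cell's `ringWinU_fail_floor` (qa-qnc0, `WalkFailFloor`) transfers:
  every strategy with cuts of `𝔽_p`-degree `≤ 1` loses α's u-walk game on `≥ 2^{n−5}` inputs (`n ≥ 5`, every charge).

Not covered by qa-qnc0's `𝔽_p` rungs (`twoShotHardF`: ≤ 2 shots; `walkHardFJunta`: one global polylog junta):
dictator strategies fire up to `n+1` shots and read every bit.  0 sorry; axioms standard; no `instance`, no
`notation`, no `native_decide`.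
-/

open Finset
open Literature.Computability.MetaComplexity Literature.Computability.MetaComplexity.Smolensky
open Summit.QuantumAdvantage.AdviceFreeQNC0

namespace Summit.QuantumAdvantage.QuantumAdvantage.Theorems.AbsorptionDial

variable {p : ℕ} [Fact p.Prime]

/-- degree `≤ 1` means affine: `h = a₀ + Σ aᵢ xᵢ` on the cube. -/
theorem affine_of_mem_lowDeg_one {F : Type*} [Field F] {n : ℕ} {h : CubeFn F n} (hh : h ∈ lowDeg F n 1) :
    ∃ a₀ : F, ∃ a : Fin n → F, ∀ x, h x = a₀ + ∑ i, a i * (if x i then 1 else 0) := by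
  rw [lowDeg_eq_span] at hh
  induction hh using Submodule.span_induction with
  | mem x hx =>
    obtain ⟨⟨S, hS⟩, rfl⟩ := hx
    rcases Nat.le_one_iff_eq_zero_or_eq_one.1 hS with h0 | h1
    · rw [Finset.card_eq_zero] at h0
      subst h0
      refine ⟨1, fun _ => 0, fun x => ?_⟩
      simp [mono_apply]
    · obtain ⟨i, rfl⟩ := Finset.card_eq_one.1 h1
      refine ⟨0, fun j => if j = i then 1 else 0, fun x => ?_⟩
      show mono F {i} x = 0 + ∑ j, (if j = i then (1 : F) else 0) * (if x j then 1 else 0)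
      rw [mono_apply, zero_add]
      simp only [ite_mul, one_mul, zero_mul, Finset.sum_ite_eq', Finset.mem_univ, if_true, Finset.mem_singleton,
        forall_eq]
  | zero => exact ⟨0, fun _ => 0, fun x => by simp⟩
  | add x y hx hy ihx ihy =>
    obtain ⟨a₀, a, ha⟩ := ihx
    obtain ⟨b₀, b, hb⟩ := ihy
    refine ⟨a₀ + b₀, fun i => a i + b i, fun z => ?_⟩
    rw [Pi.add_apply, ha, hb]
    simp only [add_mul, Finset.sum_add_distrib]
    ring
  | smul c x hx ihx =>
    obtain ⟨a₀, a, ha⟩ := ihx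
    refine ⟨c * a₀, fun i => c * a i, fun z => ?_⟩
    rw [Pi.smul_apply, ha, smul_eq_mul]
    simp only [mul_add, Finset.mul_sum, mul_assoc]

/-- the input with exactly the bits of `T` set. -/
def setBits {n : ℕ} (T : Finset (Fin n)) : Fin n → Bool := fun j => decide (j ∈ T)

/-- AbsorptionDialE helper `sum_setBits` (decomp-qadv land package; see the module docstring). -/
theorem sum_setBits {F : Type*} [Field F] {n : ℕ} (a : Fin n → F) (T : Finset (Fin n)) :
    ∑ i, a i * (if setBits T i then (1 : F) else 0) = ∑ i ∈ T, a i := by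
  unfold setBits
  simp only [decide_eq_true_eq, mul_ite, mul_one, mul_zero]
  rw [Finset.sum_ite_mem, Finset.univ_inter]

/-- `2 ≠ 0` in `𝔽_p` for an odd prime. -/
private theorem two_ne_zero_zmod' (hp2 : p ≠ 2) : (2 : ZMod p) ≠ 0 := by
  intro h
  have h' : ((2 : ℕ) : ZMod p) = 0 := by exact_mod_cast h
  rw [ZMod.natCast_eq_zero_iff] at h'
  exact hp2 ((Nat.prime_dvd_prime_iff_eq (Fact.out) Nat.prime_two).1 h')

/-- **Rigidity at degree one.**  For `p ≠ 2`, a Boolean function of `𝔽_p`-degree `≤ 1` depends on at most one bit. -/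
theorem junta_one_of_hasDegF_one (hp2 : p ≠ 2) {n : ℕ} {f : (Fin n → Bool) → Bool} (hf : HasDegF p f 1) :
    ∃ J : Finset (Fin n), J.card ≤ 1 ∧ ∀ u v : Fin n → Bool, (∀ i ∈ J, u i = v i) → f u = f v := by
  unfold HasDegF at hf
  obtain ⟨a₀, a, ha⟩ := affine_of_mem_lowDeg_one hf
  -- the indicator takes values in {0,1}
  have hval : ∀ x : Fin n → Bool, (a₀ + ∑ i, a i * (if x i then (1 : ZMod p) else 0) = 0) ∨
      (a₀ + ∑ i, a i * (if x i then (1 : ZMod p) else 0) = 1) := fun x => by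
    rw [← ha x]
    by_cases h : f x = true
    · right; rw [if_pos h]
    · left; rw [if_neg h]
  -- at most one nonzero slope
  set R : Finset (Fin n) := univ.filter fun i => a i ≠ 0 with hR
  have hRle : R.card ≤ 1 := by
    by_contra hlt
    rw [not_le] at hlt
    obtain ⟨i, hi, j, hj, hij⟩ := Finset.one_lt_card.1 hlt
    have hai : a i ≠ 0 := (Finset.mem_filter.1 hi).2
    have haj : a j ≠ 0 := (Finset.mem_filter.1 hj).2
    have h0 := hval (setBits ∅)
    have h1 := hval (setBits {i})
    have h2 := hval (setBits {j})
    have h3 := hval (setBits {i, j})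
    rw [sum_setBits] at h0 h1 h2 h3
    rw [Finset.sum_empty, add_zero] at h0
    rw [Finset.sum_singleton] at h1 h2
    rw [Finset.sum_pair hij] at h3
    have h2ne := two_ne_zero_zmod' (p := p) hp2
    rcases h0 with h0 | h0
    · rw [h0, zero_add] at h1 h2 h3
      have hi1 : a i = 1 := h1.resolve_left hai
      have hj1 : a j = 1 := h2.resolve_left haj
      rw [hi1, hj1] at h3
      rcases h3 with h3 | h3
      · exact h2ne (by linear_combination h3)
      · exact one_ne_zero (by linear_combination h3 : (1 : ZMod p) = 0)
    · rw [h0] at h1 h2 h3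
      have hi1 : a i = -1 := by
        rcases h1 with h1 | h1
        · linear_combination h1
        · exact absurd (by linear_combination h1 : a i = 0) hai
      have hj1 : a j = -1 := by
        rcases h2 with h2 | h2
        · linear_combination h2
        · exact absurd (by linear_combination h2 : a j = 0) haj
      rw [hi1, hj1] at h3
      rcases h3 with h3 | h3
      · exact one_ne_zero (by linear_combination (-1 : ZMod p) * h3 : (1 : ZMod p) = 0)
      · exact h2ne (by linear_combination (-1 : ZMod p) * h3)
  refine ⟨R, hRle, fun u v huv => ?_⟩
  -- the affine form only sees R
  have hsum : ∀ x : Fin n → Bool, ∑ i, a i * (if x i then (1 : ZMod p) else 0) =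
      ∑ i ∈ R, a i * (if x i then (1 : ZMod p) else 0) := fun x => by
    refine (Finset.sum_subset (Finset.subset_univ R) fun i _ hi => ?_).symm
    have : a i = 0 := by simpa [hR] using hi
    rw [this, zero_mul]
  have heq : (if f u = true then (1 : ZMod p) else 0) = (if f v = true then (1 : ZMod p) else 0) := by
    rw [ha u, ha v, hsum u, hsum v]
    congr 1
    exact Finset.sum_congr rfl fun i hi => by rw [huv i hi]
  by_cases hu : f u = true
  · by_cases hv : f v = true
    · rw [hu, hv]
    · rw [if_pos hu, if_neg hv] at heq; exact absurd heq one_ne_zero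
  · by_cases hv : f v = true
    · rw [if_neg hu, if_pos hv] at heq; exact absurd heq.symm one_ne_zero
    · rw [Bool.not_eq_true] at hu hv; rw [hu, hv]

/-- **Degree one transfers to `𝔽₂`.**  A Boolean function of `𝔽_p`-degree `≤ 1` has `𝔽₂`-degree `≤ 1` (every prime). -/
theorem hasDeg_of_hasDegF_one {n : ℕ} {f : (Fin n → Bool) → Bool} (hf : HasDegF p f 1) : HasDeg f 1 := by
  by_cases hp2 : p = 2
  · subst hp2
    exact hf
  · obtain ⟨J, hJ, hf'⟩ := junta_one_of_hasDegF_one hp2 hf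
    unfold HasDeg
    have h := GapFibre.ind_mem_lowDeg_of_pattern (F := ZMod 2) J (fun (i : Fin n) (u : Fin n → Bool) => u i)
      (fun i _ => bitFn_mem_lowDeg i le_rfl) f hf'
    rw [Nat.mul_one] at h
    exact lowDeg_mono hJ h

/-- **THE DEGREE-ONE FAIL FLOOR over `𝔽_p` (every prime, every charge).**  A strategy all of whose cuts have
`𝔽_p`-degree `≤ 1` loses the u-walk game on at least `2^{n−5}` of the `2ⁿ` inputs (`n ≥ 5`). -/
theorem degOne_fail_floor {n : ℕ} (hn : 5 ≤ n) (c : ℕ) (y : Fin (n + 1) → (Fin n → Bool) → Bool)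
    (hy : ∀ g, HasDegF p (y g) 1) :
    2 ^ (n - 5) ≤ (univ.filter fun u : Fin n → Bool => ringWinU c y u = false).card := by
  have h := ringWinU_fail_floor 1 (by omega : 2 * 1 + 3 ≤ n) c y fun g => hasDeg_of_hasDegF_one (hy g)
  simpa using h


/-- winners form (the T-currency at degree one): at most `2ⁿ − 2^{n−5}` winning inputs. -/
theorem degOne_win_le {n : ℕ} (hn : 5 ≤ n) (c : ℕ) (y : Fin (n + 1) → (Fin n → Bool) → Bool)
    (hy : ∀ g, HasDegF p (y g) 1) :
    (univ.filter fun u : Fin n → Bool => ringWinU c y u = true).card ≤ 2 ^ n - 2 ^ (n - 5) := by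
  have hfl := degOne_fail_floor hn c y hy
  have hsplit := Finset.card_filter_add_card_filter_not (s := (univ : Finset (Fin n → Bool)))
    (fun u : Fin n → Bool => ringWinU c y u = true)
  rw [Finset.card_univ, Fintype.card_fun, Fintype.card_bool, Fintype.card_fin] at hsplit
  have hneg : (univ.filter fun u : Fin n → Bool => ¬ ringWinU c y u = true) =
      (univ.filter fun u : Fin n → Bool => ringWinU c y u = false) :=
    Finset.filter_congr fun u _ => by rw [Bool.not_eq_true]
  rw [hneg] at hsplit
  omega

end Summit.QuantumAdvantage.QuantumAdvantage.Theorems.AbsorptionDial
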